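import Summits.AtomisticToContinuum.HydrodynamicLimit.Theses.JaynesSqueeze
import Literature.Analysis.FluidPDE.CollisionalTransfer

/-!
# `CollisionalFluxLocality` (stmt-AtomisticToContinuum-13457) — birth skeleton (`Lines/birth.lean`)

Crux K2 of route `JaynesSqueeze` (rank 3): for local-Gibbs data, `∃ σ₀ ∃ ηc ∀ σ < σ₀`, all flow
families `Φ`, `t > 0`, smooth `χ`: `∀ ε ∃ δ ∃ m₀ ∀ m ≥ m₀`, IF eventually in `N` the time-`s` laws
(`s ≤ t`) are within specific relative entropy `δ` of SOME block-constant local Gibbs law at scale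
`m` (`LG δ m`) AND the mean block densities are dilute (`DL m`), THEN eventually in `N` the
collisional momentum source `Rmom N j = E[F^j_χ(t)] − E[F^j_χ(0)] − ∫₀ᵗ E[streaming] ds` is within
`ε` of `Cmom N m j = ∫₀ᵗ Σ_B p_c(ρ_B, θ_B) ∫_B ∂_jχ ds`, `p_c(ρ,θ) = ρθ(Z(ρσ³) − 1)`, and the
collisional energy source `Ren N` is within `ε` of `Cen N m = ∫₀ᵗ Σ_B p_c(ρ_B,θ_B) u_B·∫_B∇χ ds`.

## The skeleton (BC3 birth certificate; the route's own two-layer plan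
"CollisionalFluxLocality ⇐ ContactShellEquilibration → StaticVirialIdentity", cut along the one
seam that composes by pure logic over the crux's finite-`N` vocabulary)

The crux compares a DYNAMICAL mean (`Rmom`, `Ren`: differences of one-body expectations minus the
time-integrated mean streaming flux) with a STATIC functional of the mean block fields (`Cmom`,
`Cen`). Every proof must first turn the left side into the expectation of a trajectory functional
that SEES the collisions — the tree's time-integrated collisional transfer along the flow,
`HardSphereFlow.momentumTransfer` / `HardSphereFlow.energyTransfer`
(`Literature/Analysis/FluidPDE/CollisionalTransfer.lean`: at a collision of the pair `{i,k}` the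
momentum observable `Σ_i χ(x_i) v_i^j` jumps by `(χ(x_i) − χ(x_k)) Δv_i^j`, Soto 2016 §4.8.1,
Spohn 1991 (3.7)) — and then identify the mean of that contact functional under block local
Gibbsianity. Accordingly:

* `stub_transferRepresentation` (M; finite-`N` bookkeeping IN THE MEAN, true at every `N` for
  `σ < 1/2`): `Rmom N j = E_P[(N+1)⁻¹ W_{χ e_j}(z, t)]` and `Ren N = E_P[(N+1)⁻¹ W^e_χ(z, t)]` —
  the weak balance laws `HardSphereFlow.momentumObservable_sub_eq_torus` /
  `energyObservable_sub_eq_torus` integrated against the local Gibbs law (probability measure for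
  `σ ≤ 1/2`, `isProbabilityMeasure_localGibbsLaw`; carried by the good set), Gaussian integrability
  of the one-body observables, and Fubini in `(s, z)` for the streaming term (joint measurability
  of the flow, `HardSphereFlow.aemeasurable_comp_flow_prod_torus`) — the "prover hazard" recorded in
  the route header, isolated as a lemma.
* `stub_collisionalStressClosure` (L+; the dynamical core, momentum channel): under `LG δ m` and
  `DL m`, eventually in `N` the mean normalised collisional MOMENTUM transfer over `(0, t]` against
  `χ e_j` is within `ε` of `Cmom N m j`: the contact stress of a block-Gibbsian law is isotropic with
  trace given by the virial equation of state at the block mean fields (`Z = hsCompressibility`;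
  static inputs in tree: `HardSphereVirialIdentity` (finite-`N` contact identity), the PROVED route
  supports `HsEosLowDensity`, `HardSphereLDA`). This is where "specific entropy `o(N)` does not
  control codimension-one contact statistics" (the crux's why-it-might-fail) bites.
* `stub_collisionalEnergyCurrentClosure` (L; energy channel): the mean normalised collisional
  ENERGY transfer against `χ` is within `ε` of `Cen N m`: at a contact the energy jump is
  `(χ(x_i) − χ(x_k)) ⟪Δv_i, (v_i + v_k)/2⟫`, so beyond the stress closure this needs the
  centre-of-mass velocity of colliding pairs to be slaved to the block velocity `u_B` (no collisional
  heat current at Euler order — the odd-in-velocity part of the contact statistics, which the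
  even stress closure does not see).

Composition (real proofs, no `sorry` outside the stubs): `cruxV_of_stubs : <stub₁-sig> → <stub₂-sig> →
<stub₃-sig> → CruxV` by pure logic — `σ₀ := min (min σ₂ σ₃) (1/2)`, `ηc := min η₂ η₃`, `δ := min δ₂ δ₃`,
`m₀ := max m₂ m₃`, monotonicity of `LG` in `δ` and of `DL` in `ηc` (`LG_mono`, `DL_mono`), intersection
of three eventualities, and the two identities of the representation stub rewrite `Rmom`, `Ren` into the
transfer means — and the skeleton theorem `CollisionalFluxLocality_of : JaynesSqueeze.CollisionalFluxLocality
:= cruxIff.mpr (cruxV_of_stubs stub_… stub_… stub_…)` concludes the crux BY NAME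
(`cruxIff : CollisionalFluxLocality ↔ CruxV := Iff.rfl`: the vocabulary below is definitionally the crux's
`let` chain). `lean check`: rc 0, 3 sorries = 3 stubs, zero elsewhere.

BC3 probes (folder `bc/probe2_<stub>_{crux,summit}.lean`, one tactic per example, 400k heartbeats):
for each of the three stub statements `S`, `example : S → CollisionalFluxLocality` and
`example : S → _root_.HydrodynamicLimit` by `exact?` / `simpa` / `simpa [target]` / `aesop` — 24/24 FAIL
(`exact?` "could not close the goal" ×6; `simpa` "assumption failed" ×6; `simpa [crux]` heartbeat
timeout ×3, `simpa [HydrodynamicLimit]` "assumption failed" ×3; `aesop` "failed after exhaustive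
search" ×6): no stub is cheaply the crux or the summit conjunct.

Disproof used: no `Cruxes/CollisionalFluxLocality/Disproof.lean` exists at registration (checked
`ledger crux ls`); the refuter's crux-attack (evidence EVIDENCE.md on the item) found the statement
satisfiable and exact (`0 = 0`) at global boosted equilibrium — all three stubs hold there too
(the transfer means are then stationary and the representation is an identity).
-/

noncomputable section

namespace Summit.AtomisticToContinuum.HydrodynamicLimit.Cruxes.CollisionalFluxLocality.Birth

open scoped BigOperators Topology Classical MeasureTheory ProbabilityTheory Matrix InnerProductSpace ComplexConjugate ContinuousMap
open Filter Set Function TopologicalSpace MeasureTheory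
open Literature.MathematicalPhysics.KineticTheory

/-! ## Vocabulary: the crux's `let` chain as definitions (parameters `σ a₀ θ₀ u₀ Φ t χ`) -/

/-- Phase space of `N + 1` spheres on `𝕋³`. [folklore] -/
abbrev Cfg (N : ℕ) : Type := Literature.Analysis.FluidPDE.Config (N + 1) (Fin 3) (UnitAddTorus (Fin 3))

/-- A hard-sphere flow of `N + 1` spheres of diameter `hsDiameter σ N` for every `N` (the crux's `Φ`). [folklore] -/
abbrev Flows (σ : ℝ) : Type :=
  (N : ℕ) → Literature.Analysis.FluidPDE.HardSphereFlow (Literature.Analysis.FluidPDE.Torus.geometry (Fin 3))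
    (hsDiameter σ N) (N + 1)

variable (σ : ℝ) (a₀ θ₀ : (UnitAddTorus (Fin 3)) → ℝ) (u₀ : (UnitAddTorus (Fin 3)) → (EuclideanSpace ℝ (Fin 3)))
  (Φ : Flows σ)

/-- `P N`: the initial local Gibbs law. [folklore] -/
def lawP (N : ℕ) : Measure (Cfg N) := localGibbsLaw σ a₀ u₀ θ₀ N (Φ N)

/-- `μ N s`: the one-body INTENSITY measure `(N+1)⁻¹ Σ_i law(z_i(s))` on `𝕋³ × ℝ³`. [folklore] -/
def intensity (N : ℕ) (s : ℝ) : Measure ((UnitAddTorus (Fin 3)) × (EuclideanSpace ℝ (Fin 3))) :=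
  ((N : ENNReal) + 1)⁻¹ • MeasureTheory.Measure.sum (fun i : Fin (N + 1) => ((Φ N).lawAt (lawP σ a₀ θ₀ u₀ Φ N) s).map (fun z => z i))

/-- `idx m x`: the cube of side `1/m` containing `x`. [folklore] -/
def idx (m : ℕ) (x : UnitAddTorus (Fin 3)) : Fin 3 → ℕ :=
  fun i => ⌊(m : ℝ) * Literature.Analysis.FunctionSpaces.Torus.repr x i⌋₊

/-- `μB N s m k`: velocity law of the intensity measure restricted to the cube `k`. [folklore] -/
def blockLaw (N : ℕ) (s : ℝ) (m : ℕ) (k : Fin 3 → ℕ) : Measure (EuclideanSpace ℝ (Fin 3)) :=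
  ((intensity σ a₀ θ₀ u₀ Φ N s).restrict ({x : (UnitAddTorus (Fin 3)) | idx m x = k} ×ˢ (Set.univ : Set (EuclideanSpace ℝ (Fin 3))))).snd

/-- Block mass. [folklore] -/
def mass (N : ℕ) (s : ℝ) (m : ℕ) (k : Fin 3 → ℕ) : ℝ := ((blockLaw σ a₀ θ₀ u₀ Φ N s m k) Set.univ).toReal

/-- Block mean velocity. [folklore] -/
def vel (N : ℕ) (s : ℝ) (m : ℕ) (k : Fin 3 → ℕ) : EuclideanSpace ℝ (Fin 3) :=
  (mass σ a₀ θ₀ u₀ Φ N s m k)⁻¹ • ∫ v, v ∂(blockLaw σ a₀ θ₀ u₀ Φ N s m k)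

/-- Block kinetic temperature (in-block velocity variance counts as heat). [folklore] -/
def temp (N : ℕ) (s : ℝ) (m : ℕ) (k : Fin 3 → ℕ) : ℝ :=
  (3 * mass σ a₀ θ₀ u₀ Φ N s m k)⁻¹ * ∫ v, ‖v - vel σ a₀ θ₀ u₀ Φ N s m k‖ ^ 2 ∂(blockLaw σ a₀ θ₀ u₀ Φ N s m k)

/-- `w y = v · ∇χ(x)`. [folklore] -/
def wgt (χ : (UnitAddTorus (Fin 3)) → ℝ) (y : (UnitAddTorus (Fin 3)) × (EuclideanSpace ℝ (Fin 3))) : ℝ :=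
  ∑ l : Fin 3, y.2 l * Literature.Analysis.FunctionSpaces.Torus.partialDeriv l χ y.1

/-- `gI m k j = ∫_{cube k} ∂_j χ`. [folklore] -/
def gI (χ : (UnitAddTorus (Fin 3)) → ℝ) (m : ℕ) (k : Fin 3 → ℕ) (j : Fin 3) : ℝ :=
  ∫ x in {x : (UnitAddTorus (Fin 3)) | idx m x = k}, Literature.Analysis.FunctionSpaces.Torus.partialDeriv j χ x

/-- `E[F^j_χ(s)]`: mean empirical momentum field at time `s`. [folklore] -/
def Emom (χ : (UnitAddTorus (Fin 3)) → ℝ) (N : ℕ) (s : ℝ) (j : Fin 3) : ℝ :=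
  ∫ z, empiricalMomentumField ((Φ N).flow s z) χ j ∂(lawP σ a₀ θ₀ u₀ Φ N)

/-- Mean streaming momentum flux at time `s`. [folklore] -/
def Ekin (χ : (UnitAddTorus (Fin 3)) → ℝ) (N : ℕ) (s : ℝ) (j : Fin 3) : ℝ :=
  ∫ z, ((N : ℝ) + 1)⁻¹ * ∑ i : Fin (N + 1), wgt χ ((Φ N).flow s z i) * ((Φ N).flow s z i).2 j ∂(lawP σ a₀ θ₀ u₀ Φ N)

/-- `Rmom N j`: the collisional momentum source over `[0, t]`. [folklore] -/
def Rmom (t : ℝ) (χ : (UnitAddTorus (Fin 3)) → ℝ) (N : ℕ) (j : Fin 3) : ℝ :=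
  Emom σ a₀ θ₀ u₀ Φ χ N t j - Emom σ a₀ θ₀ u₀ Φ χ N 0 j - ∫ s in (0 : ℝ)..t, Ekin σ a₀ θ₀ u₀ Φ χ N s j

/-- Collisional pressure `p_c(r, ϑ) = rϑ(Z(rσ³) − 1)`. [folklore] -/
def pc (r ϑ : ℝ) : ℝ := r * ϑ * (hsCompressibility (r * σ ^ 3) - 1)

/-- `Cmom N m j`: the block equation-of-state functional, momentum channel. [folklore] -/
def Cmom (t : ℝ) (χ : (UnitAddTorus (Fin 3)) → ℝ) (N : ℕ) (m : ℕ) (j : Fin 3) : ℝ :=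
  ∫ s in (0 : ℝ)..t, ∑ k ∈ Fintype.piFinset (fun _ : Fin 3 => Finset.range m),
    pc σ ((m : ℝ) ^ 3 * mass σ a₀ θ₀ u₀ Φ N s m k) (temp σ a₀ θ₀ u₀ Φ N s m k) * gI χ m k j

/-- `E[E_χ(s)]`: mean empirical energy field at time `s`. [folklore] -/
def Een (χ : (UnitAddTorus (Fin 3)) → ℝ) (N : ℕ) (s : ℝ) : ℝ :=
  ∫ z, empiricalEnergyField ((Φ N).flow s z) χ ∂(lawP σ a₀ θ₀ u₀ Φ N)

/-- Mean streaming energy flux at time `s`. [folklore] -/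
def Ekin3 (χ : (UnitAddTorus (Fin 3)) → ℝ) (N : ℕ) (s : ℝ) : ℝ :=
  ∫ z, ((N : ℝ) + 1)⁻¹ * ∑ i : Fin (N + 1), wgt χ ((Φ N).flow s z i) * (‖((Φ N).flow s z i).2‖ ^ 2 / 2) ∂(lawP σ a₀ θ₀ u₀ Φ N)

/-- `Ren N`: the collisional energy source over `[0, t]`. [folklore] -/
def Ren (t : ℝ) (χ : (UnitAddTorus (Fin 3)) → ℝ) (N : ℕ) : ℝ :=
  Een σ a₀ θ₀ u₀ Φ χ N t - Een σ a₀ θ₀ u₀ Φ χ N 0 - ∫ s in (0 : ℝ)..t, Ekin3 σ a₀ θ₀ u₀ Φ χ N s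

/-- `Cen N m`: the block equation-of-state functional, energy channel. [folklore] -/
def Cen (t : ℝ) (χ : (UnitAddTorus (Fin 3)) → ℝ) (N : ℕ) (m : ℕ) : ℝ :=
  ∫ s in (0 : ℝ)..t, ∑ k ∈ Fintype.piFinset (fun _ : Fin 3 => Finset.range m),
    pc σ ((m : ℝ) ^ 3 * mass σ a₀ θ₀ u₀ Φ N s m k) (temp σ a₀ θ₀ u₀ Φ N s m k) *
      ∑ j : Fin 3, vel σ a₀ θ₀ u₀ Φ N s m k j * gI χ m k j

/-- `DL m` at packing threshold `ηc`: eventually the mean block densities are dilute. [folklore] -/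
def DL (t ηc : ℝ) (m : ℕ) : Prop :=
  ∀ᶠ N : ℕ in Filter.atTop, ∀ s ∈ Set.Icc 0 t, ∀ k : Fin 3 → ℕ, (m : ℝ) ^ 3 * mass σ a₀ θ₀ u₀ Φ N s m k * σ ^ 3 ≤ ηc

/-- `LG δ m`: eventually the time-`s` laws are within specific relative entropy `δ` of SOME
block-constant local Gibbs law at scale `m`. [folklore] -/
def LG (t δ : ℝ) (m : ℕ) : Prop :=
  ∀ᶠ N : ℕ in Filter.atTop, ∀ s ∈ Set.Icc 0 t,
    ∃ (ca cθ : (Fin 3 → ℕ) → ℝ) (cu : (Fin 3 → ℕ) → (EuclideanSpace ℝ (Fin 3))), (∀ k, 0 < ca k ∧ 0 < cθ k) ∧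
      InformationTheory.klDiv ((Φ N).lawAt (lawP σ a₀ θ₀ u₀ Φ N) s)
        (localGibbsLaw σ (fun x => ca (idx m x)) (fun x => cu (idx m x)) (fun x => cθ (idx m x)) N (Φ N)) ≤
        ENNReal.ofReal (δ * ((N : ℝ) + 1))

/-- NEW (not in the crux): `Wmom N j = E_P[(N+1)⁻¹ W_{χ e_j}(z, t)]`, the mean normalised
time-integrated collisional MOMENTUM transfer over `(0, t]` against the test field `x ↦ χ(x) e_j`
(`HardSphereFlow.momentumTransfer`). [folklore] -/
def Wmom (t : ℝ) (χ : (UnitAddTorus (Fin 3)) → ℝ) (N : ℕ) (j : Fin 3) : ℝ :=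
  ∫ z, ((N : ℝ) + 1)⁻¹ * (Φ N).momentumTransfer (fun x => χ x • EuclideanSpace.single j (1 : ℝ)) z t ∂(lawP σ a₀ θ₀ u₀ Φ N)

/-- NEW (not in the crux): `Wen N = E_P[(N+1)⁻¹ W^e_χ(z, t)]`, the mean normalised time-integrated
collisional ENERGY transfer over `(0, t]` against `χ` (`HardSphereFlow.energyTransfer`). [folklore] -/
def Wen (t : ℝ) (χ : (UnitAddTorus (Fin 3)) → ℝ) (N : ℕ) : ℝ :=
  ∫ z, ((N : ℝ) + 1)⁻¹ * (Φ N).energyTransfer χ z t ∂(lawP σ a₀ θ₀ u₀ Φ N)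

/-- The crux in this vocabulary (definitionally equal to the route decl, `cruxIff`). [folklore] -/
def CruxV : Prop :=
  ∀ (a₀ θ₀ : (UnitAddTorus (Fin 3)) → ℝ) (u₀ : (UnitAddTorus (Fin 3)) → (EuclideanSpace ℝ (Fin 3))),
    Continuous a₀ → Continuous θ₀ → Continuous u₀ → (∀ x, 0 < a₀ x) → (∀ x, 0 < θ₀ x) →
    ∃ σ₀ : ℝ, 0 < σ₀ ∧ ∃ ηc : ℝ, 0 < ηc ∧ ∀ σ : ℝ, 0 < σ → σ < σ₀ → ∀ Φ : Flows σ, ∀ t : ℝ, 0 < t →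
      ∀ χ : (UnitAddTorus (Fin 3)) → ℝ, Literature.Analysis.FunctionSpaces.Torus.IsSmooth χ →
        ∀ ε : ℝ, 0 < ε → ∃ δ : ℝ, 0 < δ ∧ ∃ m₀ : ℕ, ∀ m : ℕ, m₀ ≤ m → LG σ a₀ θ₀ u₀ Φ t δ m → DL σ a₀ θ₀ u₀ Φ t ηc m →
          ∀ᶠ N : ℕ in Filter.atTop,
            (∀ j : Fin 3, |Rmom σ a₀ θ₀ u₀ Φ t χ N j - Cmom σ a₀ θ₀ u₀ Φ t χ N m j| ≤ ε) ∧
              |Ren σ a₀ θ₀ u₀ Φ t χ N - Cen σ a₀ θ₀ u₀ Φ t χ N m| ≤ ε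

/-! ## The crux by name -/

/-- The route decl `JaynesSqueeze.CollisionalFluxLocality` is definitionally the vocabulary form
`CruxV` (its `let` chain is exactly the definitions above). [folklore] -/
theorem cruxIff :
    _root_.Summit.AtomisticToContinuum.HydrodynamicLimit.Theses.JaynesSqueeze.CollisionalFluxLocality ↔ CruxV :=
  Iff.rfl

/-! ## Monotonicity of the two hypotheses of the crux -/

variable {σ a₀ θ₀ u₀ Φ}

/-- `LG` is monotone in the entropy budget `δ`. [folklore] -/
theorem LG_mono {t δ δ' : ℝ} {m : ℕ} (h : δ ≤ δ') (hLG : LG σ a₀ θ₀ u₀ Φ t δ m) :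
    LG σ a₀ θ₀ u₀ Φ t δ' m := by
  refine Filter.Eventually.mono hLG fun _N hN s hs => ?_
  obtain ⟨ca, cθ, cu, hpos, hkl⟩ := hN s hs
  refine ⟨ca, cθ, cu, hpos, hkl.trans (ENNReal.ofReal_le_ofReal ?_)⟩
  exact mul_le_mul_of_nonneg_right h (by positivity)

/-- `DL` is monotone in the packing threshold `ηc`. [folklore] -/
theorem DL_mono {t η η' : ℝ} {m : ℕ} (h : η ≤ η') (hDL : DL σ a₀ θ₀ u₀ Φ t η m) :
    DL σ a₀ θ₀ u₀ Φ t η' m :=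
  Filter.Eventually.mono hDL fun _N hN s hs k => (hN s hs k).trans h

/-! ## Stubs (the only `sorry`s) -/

/-- **Stub 1 — transfer representation (finite-`N` bookkeeping in the mean; M).** For `σ < 1/2`
(local Gibbs laws are probability measures at every `N`, `isProbabilityMeasure_localGibbsLaw`) and
every `N`: the collisional momentum source `Rmom N j` IS the mean normalised time-integrated
collisional momentum transfer `E_P[(N+1)⁻¹ W_{χ e_j}(z,t)]` along the flow, and the collisional
energy source `Ren N` IS `E_P[(N+1)⁻¹ W^e_χ(z,t)]` — the weak balance laws
`HardSphereFlow.momentumObservable_sub_eq_torus` / `energyObservable_sub_eq_torus` on the good set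
(full measure), integrated against `P N` (Gaussian integrability of the one-body observables) with
Fubini in `(s, z)` for the streaming term (`HardSphereFlow.aemeasurable_comp_flow_prod_torus`), and
`∂_l` vs `Torus.fderiv` for smooth `χ`. [folklore] -/
theorem stub_transferRepresentation :
    ∀ (a₀ θ₀ : (UnitAddTorus (Fin 3)) → ℝ) (u₀ : (UnitAddTorus (Fin 3)) → (EuclideanSpace ℝ (Fin 3))),
      Continuous a₀ → Continuous θ₀ → Continuous u₀ → (∀ x, 0 < a₀ x) → (∀ x, 0 < θ₀ x) →
      ∀ σ : ℝ, 0 < σ → σ < 1 / 2 → ∀ Φ : Flows σ, ∀ t : ℝ, 0 < t →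
        ∀ χ : (UnitAddTorus (Fin 3)) → ℝ, Literature.Analysis.FunctionSpaces.Torus.IsSmooth χ →
          ∀ N : ℕ, (∀ j : Fin 3, Rmom σ a₀ θ₀ u₀ Φ t χ N j = Wmom σ a₀ θ₀ u₀ Φ t χ N j) ∧
            Ren σ a₀ θ₀ u₀ Φ t χ N = Wen σ a₀ θ₀ u₀ Φ t χ N := by
  sorry

/-- **Stub 2 — collisional stress closure (the dynamical core, momentum channel; L+).** For
local-Gibbs data `∃ σ₀ ∃ ηc ∀ σ < σ₀ ∀ Φ ∀ t > 0 ∀ χ` smooth: `∀ ε ∃ δ ∃ m₀ ∀ m ≥ m₀`, block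
local Gibbsianity in specific relative entropy (`LG δ m`) and dilute mean blocks (`DL m`) force,
eventually in `N`, the mean normalised collisional momentum transfer over `(0,t]` against `χ e_j`
to be within `ε` of `∫₀ᵗ Σ_B p_c(ρ_B, θ_B) ∫_B ∂_jχ ds`: the contact stress of a block-Gibbsian law
is isotropic with trace `ρθ(Z(ρσ³) − 1)` at the block MEAN fields (virial equation of state; finite-`N`
contact identity `HardSphereVirialIdentity`, thermodynamic limit via the proved `HsEosLowDensity` /
`HardSphereLDA`). Why it might fail: an `o(N)` entropy distortion concentrated at contact changes
the contact value by `O(1)` (the crux's own risk, carried entirely by this stub and Stub 3). [folklore] -/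
theorem stub_collisionalStressClosure :
    ∀ (a₀ θ₀ : (UnitAddTorus (Fin 3)) → ℝ) (u₀ : (UnitAddTorus (Fin 3)) → (EuclideanSpace ℝ (Fin 3))),
      Continuous a₀ → Continuous θ₀ → Continuous u₀ → (∀ x, 0 < a₀ x) → (∀ x, 0 < θ₀ x) →
      ∃ σ₀ : ℝ, 0 < σ₀ ∧ ∃ ηc : ℝ, 0 < ηc ∧ ∀ σ : ℝ, 0 < σ → σ < σ₀ → ∀ Φ : Flows σ, ∀ t : ℝ, 0 < t →
        ∀ χ : (UnitAddTorus (Fin 3)) → ℝ, Literature.Analysis.FunctionSpaces.Torus.IsSmooth χ →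
          ∀ ε : ℝ, 0 < ε → ∃ δ : ℝ, 0 < δ ∧ ∃ m₀ : ℕ, ∀ m : ℕ, m₀ ≤ m →
            LG σ a₀ θ₀ u₀ Φ t δ m → DL σ a₀ θ₀ u₀ Φ t ηc m →
              ∀ᶠ N : ℕ in Filter.atTop,
                ∀ j : Fin 3, |Wmom σ a₀ θ₀ u₀ Φ t χ N j - Cmom σ a₀ θ₀ u₀ Φ t χ N m j| ≤ ε := by
  sorry

/-- **Stub 3 — collisional energy-current closure (energy channel; L).** Same hypotheses; the
mean normalised collisional ENERGY transfer over `(0,t]` against `χ` is eventually within `ε` of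
`∫₀ᵗ Σ_B p_c(ρ_B, θ_B) u_B · ∫_B ∇χ ds`. At a contact of the pair `{i,k}` the energy jump is
`(χ(x_i) − χ(x_k)) ⟪Δv_i, (v_i + v_k)/2⟫` (`collisionJump_energyObservable`), so beyond Stub 2 this
needs the centre-of-mass velocity of colliding pairs to be slaved to the block velocity `u_B`
(no collisional heat current at Euler order: the odd-in-velocity contact statistics). [folklore] -/
theorem stub_collisionalEnergyCurrentClosure :
    ∀ (a₀ θ₀ : (UnitAddTorus (Fin 3)) → ℝ) (u₀ : (UnitAddTorus (Fin 3)) → (EuclideanSpace ℝ (Fin 3))),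
      Continuous a₀ → Continuous θ₀ → Continuous u₀ → (∀ x, 0 < a₀ x) → (∀ x, 0 < θ₀ x) →
      ∃ σ₀ : ℝ, 0 < σ₀ ∧ ∃ ηc : ℝ, 0 < ηc ∧ ∀ σ : ℝ, 0 < σ → σ < σ₀ → ∀ Φ : Flows σ, ∀ t : ℝ, 0 < t →
        ∀ χ : (UnitAddTorus (Fin 3)) → ℝ, Literature.Analysis.FunctionSpaces.Torus.IsSmooth χ →
          ∀ ε : ℝ, 0 < ε → ∃ δ : ℝ, 0 < δ ∧ ∃ m₀ : ℕ, ∀ m : ℕ, m₀ ≤ m →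
            LG σ a₀ θ₀ u₀ Φ t δ m → DL σ a₀ θ₀ u₀ Φ t ηc m →
              ∀ᶠ N : ℕ in Filter.atTop,
                |Wen σ a₀ θ₀ u₀ Φ t χ N - Cen σ a₀ θ₀ u₀ Φ t χ N m| ≤ ε := by
  sorry

/-! ## Composition: the three stubs imply the crux, by name -/

/-- **The three stub STATEMENTS imply the crux in vocabulary form** (pure logic, sorry-free: `σ₀ := min
(min σ₂ σ₃) (1/2)`, `ηc := min η₂ η₃`, `δ := min δ₂ δ₃`, `m₀ := max m₂ m₃`, `LG_mono`, `DL_mono`,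
intersection of eventualities, and the representation identities rewrite `Rmom`, `Ren`). The hypotheses
are verbatim the types of `stub_transferRepresentation`, `stub_collisionalStressClosure`,
`stub_collisionalEnergyCurrentClosure`. [folklore] -/
theorem cruxV_of_stubs :
    (∀ (a₀ θ₀ : (UnitAddTorus (Fin 3)) → ℝ) (u₀ : (UnitAddTorus (Fin 3)) → (EuclideanSpace ℝ (Fin 3))),
      Continuous a₀ → Continuous θ₀ → Continuous u₀ → (∀ x, 0 < a₀ x) → (∀ x, 0 < θ₀ x) →
      ∀ σ : ℝ, 0 < σ → σ < 1 / 2 → ∀ Φ : Flows σ, ∀ t : ℝ, 0 < t →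
        ∀ χ : (UnitAddTorus (Fin 3)) → ℝ, Literature.Analysis.FunctionSpaces.Torus.IsSmooth χ →
          ∀ N : ℕ, (∀ j : Fin 3, Rmom σ a₀ θ₀ u₀ Φ t χ N j = Wmom σ a₀ θ₀ u₀ Φ t χ N j) ∧
            Ren σ a₀ θ₀ u₀ Φ t χ N = Wen σ a₀ θ₀ u₀ Φ t χ N) →
    (∀ (a₀ θ₀ : (UnitAddTorus (Fin 3)) → ℝ) (u₀ : (UnitAddTorus (Fin 3)) → (EuclideanSpace ℝ (Fin 3))),
      Continuous a₀ → Continuous θ₀ → Continuous u₀ → (∀ x, 0 < a₀ x) → (∀ x, 0 < θ₀ x) →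
      ∃ σ₀ : ℝ, 0 < σ₀ ∧ ∃ ηc : ℝ, 0 < ηc ∧ ∀ σ : ℝ, 0 < σ → σ < σ₀ → ∀ Φ : Flows σ, ∀ t : ℝ, 0 < t →
        ∀ χ : (UnitAddTorus (Fin 3)) → ℝ, Literature.Analysis.FunctionSpaces.Torus.IsSmooth χ →
          ∀ ε : ℝ, 0 < ε → ∃ δ : ℝ, 0 < δ ∧ ∃ m₀ : ℕ, ∀ m : ℕ, m₀ ≤ m →
            LG σ a₀ θ₀ u₀ Φ t δ m → DL σ a₀ θ₀ u₀ Φ t ηc m →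
              ∀ᶠ N : ℕ in Filter.atTop,
                ∀ j : Fin 3, |Wmom σ a₀ θ₀ u₀ Φ t χ N j - Cmom σ a₀ θ₀ u₀ Φ t χ N m j| ≤ ε) →
    (∀ (a₀ θ₀ : (UnitAddTorus (Fin 3)) → ℝ) (u₀ : (UnitAddTorus (Fin 3)) → (EuclideanSpace ℝ (Fin 3))),
      Continuous a₀ → Continuous θ₀ → Continuous u₀ → (∀ x, 0 < a₀ x) → (∀ x, 0 < θ₀ x) →
      ∃ σ₀ : ℝ, 0 < σ₀ ∧ ∃ ηc : ℝ, 0 < ηc ∧ ∀ σ : ℝ, 0 < σ → σ < σ₀ → ∀ Φ : Flows σ, ∀ t : ℝ, 0 < t →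
        ∀ χ : (UnitAddTorus (Fin 3)) → ℝ, Literature.Analysis.FunctionSpaces.Torus.IsSmooth χ →
          ∀ ε : ℝ, 0 < ε → ∃ δ : ℝ, 0 < δ ∧ ∃ m₀ : ℕ, ∀ m : ℕ, m₀ ≤ m →
            LG σ a₀ θ₀ u₀ Φ t δ m → DL σ a₀ θ₀ u₀ Φ t ηc m →
              ∀ᶠ N : ℕ in Filter.atTop,
                |Wen σ a₀ θ₀ u₀ Φ t χ N - Cen σ a₀ θ₀ u₀ Φ t χ N m| ≤ ε) →
    CruxV := by
  intro h1 h2 h3 a₀ θ₀ u₀ ha hθ hu hap hθp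
  obtain ⟨σ₂, hσ₂, η₂, hη₂, H2⟩ := h2 a₀ θ₀ u₀ ha hθ hu hap hθp
  obtain ⟨σ₃, hσ₃, η₃, hη₃, H3⟩ := h3 a₀ θ₀ u₀ ha hθ hu hap hθp
  refine ⟨min (min σ₂ σ₃) (1 / 2), lt_min (lt_min hσ₂ hσ₃) (by norm_num), min η₂ η₃, lt_min hη₂ hη₃, ?_⟩
  intro σ hσ hσlt Φ t ht χ hχ ε hε
  have hσ23 : σ < min σ₂ σ₃ := hσlt.trans_le (min_le_left _ _)
  have hσhalf : σ < 1 / 2 := hσlt.trans_le (min_le_right _ _)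
  obtain ⟨δ₂, hδ₂, m₂, Hm₂⟩ := H2 σ hσ (hσ23.trans_le (min_le_left _ _)) Φ t ht χ hχ ε hε
  obtain ⟨δ₃, hδ₃, m₃, Hm₃⟩ := H3 σ hσ (hσ23.trans_le (min_le_right _ _)) Φ t ht χ hχ ε hε
  refine ⟨min δ₂ δ₃, lt_min hδ₂ hδ₃, max m₂ m₃, fun m hm hLG hDL => ?_⟩
  have hR := h1 a₀ θ₀ u₀ ha hθ hu hap hθp σ hσ hσhalf Φ t ht χ hχ
  have hN2 := Hm₂ m (le_of_max_le_left hm) (LG_mono (min_le_left _ _) hLG) (DL_mono (min_le_left _ _) hDL)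
  have hN3 := Hm₃ m (le_of_max_le_right hm) (LG_mono (min_le_right _ _) hLG) (DL_mono (min_le_right _ _) hDL)
  filter_upwards [hN2, hN3] with N h2N h3N
  refine ⟨fun j => ?_, ?_⟩
  · rw [(hR N).1 j]
    exact h2N j
  · rw [(hR N).2]
    exact h3N

/-- **The skeleton theorem: `CollisionalFluxLocality` BY NAME from the three declared stubs** — the
route decl is definitionally `CruxV` (`cruxIff`), and `cruxV_of_stubs` is fed the stubs. No `sorry` here;
the only `sorryAx` in the closure sits inside `stub_transferRepresentation`,
`stub_collisionalStressClosure`, `stub_collisionalEnergyCurrentClosure`. [folklore] -/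
theorem CollisionalFluxLocality_of :
    _root_.Summit.AtomisticToContinuum.HydrodynamicLimit.Theses.JaynesSqueeze.CollisionalFluxLocality :=
  cruxIff.mpr (cruxV_of_stubs stub_transferRepresentation stub_collisionalStressClosure
    stub_collisionalEnergyCurrentClosure)

end Summit.AtomisticToContinuum.HydrodynamicLimit.Cruxes.CollisionalFluxLocality.Birth

end
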